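import Mathlib.Analysis.Matrix.Spectrum
import Mathlib.Analysis.Matrix.PosDef
import Mathlib.Analysis.SpecialFunctions.Log.Basic
import Mathlib.Analysis.SpecialFunctions.Exp
import Literature.Computability.AlgebraicComplexity.TensorPowerAction
import HarnessLib

/-!
# The Cartan (`KAK`) decomposition of `SL_σ(ℂ)` and unitary invariance of matrix norms

Support file for the proof of Bürgisser–Ikenmeyer 2017, Cor. 2.9 (`det_n` and `per_n` are
polystable, `Polystability.lean`), Kempf–Ness part. Proved here, from Mathlib's spectral
theorem for Hermitian matrices (`Matrix.IsHermitian.spectral_theorem`):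

* `exists_unitary_diag_conjTranspose_mul_self_of_det_eq_one` — for `det g = 1`,
  `gᴴ g = U diag(d) Uᴴ` with `U` unitary, `d > 0`, `∏ d = 1`;
* `exists_kak_of_det_eq_one` — **`KAK`**: `g = V * diag(exp θ) * W` with `V, W` unitary, `θ` real,
  `∑ θ = 0` (singular value decomposition; Knapp, *Lie groups beyond an introduction*, Thm. 7.39
  for `SL_n(ℂ)`, here in matrix form);
* unitary invariance of column norms, row norms and the squared Frobenius norm
  (`colNormSq_mul_of_conjTranspose_mul_self`, `rowNormSq_mul_of_mul_conjTranspose_self`,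
  `frobSq_mul_of_mul_conjTranspose_self`) and the column norms of `V diag(e^θ) X`
  (`colNormSq_unitary_mul_diagonal_mul`).

Everything is proved; [folklore].

## References

* A. W. Knapp, *Lie Groups Beyond an Introduction*, 2nd ed., Birkhäuser (2002), Thm. 7.39
  (`KAK` decomposition).
* G. Kempf, L. Ness, *The length of vectors in representation spaces*, LNM 732 (1979), §1.
-/

noncomputable section

open Finset
open scoped Matrix ComplexOrder

namespace Literature.Computability.AlgebraicComplexity

variable {σ : Type*} [Fintype σ] [DecidableEq σ]

/-- For a complex matrix `g` of determinant `1`, the positive matrix `gᴴg` is `U diag(d) Uᴴ` with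
`U` unitary and real `d > 0` of product `1` (spectral theorem). [folklore] -/
theorem exists_unitary_diag_conjTranspose_mul_self_of_det_eq_one (g : Matrix σ σ ℂ)
    (hg : g.det = 1) :
    ∃ (U : Matrix σ σ ℂ) (d : σ → ℝ), U ∈ Matrix.unitaryGroup σ ℂ ∧ (∀ i, 0 < d i) ∧
      ∏ i, d i = 1 ∧ gᴴ * g = U * Matrix.diagonal (fun i => (d i : ℂ)) * star U := by
  have hP : (gᴴ * g).PosSemidef := Matrix.posSemidef_conjTranspose_mul_self g
  have hdec : gᴴ * g = (hP.1.eigenvectorUnitary : Matrix σ σ ℂ) *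
      Matrix.diagonal (fun i => (hP.1.eigenvalues i : ℂ)) *
        star (hP.1.eigenvectorUnitary : Matrix σ σ ℂ) := by
    conv_lhs => rw [hP.1.spectral_theorem, Unitary.conjStarAlgAut_apply]
    rfl
  have hdet : (gᴴ * g).det = 1 := by
    rw [Matrix.det_mul, Matrix.det_conjTranspose, hg, star_one, one_mul]
  have hprod : (RCLike.ofReal (∏ i, hP.1.eigenvalues i) : ℂ) = 1 := by
    rw [RCLike.ofReal_prod, ← hP.1.det_eq_prod_eigenvalues, hdet]
  have hprod' : ∏ i, hP.1.eigenvalues i = 1 :=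
    RCLike.ofReal_injective (K := ℂ) (hprod.trans RCLike.ofReal_one.symm)
  have hpos : ∀ i, 0 < hP.1.eigenvalues i := fun i =>
    (hP.eigenvalues_nonneg i).lt_of_ne fun h0 => by
      have : ∏ i, hP.1.eigenvalues i = 0 := Finset.prod_eq_zero (Finset.mem_univ i) h0.symm
      rw [hprod'] at this
      exact one_ne_zero this
  exact ⟨(hP.1.eigenvectorUnitary : Matrix σ σ ℂ), hP.1.eigenvalues, SetLike.coe_mem _, hpos, hprod',
    hdec⟩

/-- **Cartan (`KAK`) decomposition of `SL_σ(ℂ)`**: every complex matrix of determinant `1` is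
`V * diag(exp θ) * W` with `V, W` unitary and `θ` real of sum `0` (singular value decomposition).
[folklore] -/
theorem exists_kak_of_det_eq_one (g : Matrix σ σ ℂ) (hg : g.det = 1) :
    ∃ (V W : Matrix σ σ ℂ) (θ : σ → ℝ), V ∈ Matrix.unitaryGroup σ ℂ ∧ W ∈ Matrix.unitaryGroup σ ℂ ∧
      ∑ a, θ a = 0 ∧ g = V * Matrix.diagonal (fun a => (Real.exp (θ a) : ℂ)) * W := by
  obtain ⟨U, d, hU, hdpos, hdprod, hdec⟩ :=
    exists_unitary_diag_conjTranspose_mul_self_of_det_eq_one g hg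
  have hUU : U * star U = 1 := Matrix.mem_unitaryGroup_iff.mp hU
  have hUU' : star U * U = 1 := Matrix.mem_unitaryGroup_iff'.mp hU
  set θ : σ → ℝ := fun a => Real.log (d a) / 2 with hθ
  have hexp : ∀ a, Real.exp (θ a) * Real.exp (θ a) = d a := by
    intro a
    rw [← Real.exp_add, hθ]
    simp only
    rw [add_halves, Real.exp_log (hdpos a)]
  have hexp_ne : ∀ a, (Real.exp (θ a) : ℂ) ≠ 0 := fun a =>
    Complex.ofReal_ne_zero.mpr (Real.exp_pos _).ne'
  -- the three factors
  set D : Matrix σ σ ℂ := Matrix.diagonal (fun a => (Real.exp (θ a) : ℂ)) with hD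
  set Dinv : Matrix σ σ ℂ := Matrix.diagonal (fun a => ((Real.exp (θ a) : ℂ))⁻¹) with hDinv
  have hDD : Dinv * D = 1 := by
    rw [hD, hDinv, Matrix.diagonal_mul_diagonal, ← Matrix.diagonal_one]
    congr 1
    funext a
    rw [inv_mul_cancel₀ (hexp_ne a)]
  have hDstar : star Dinv = Dinv := by
    rw [hDinv, Matrix.star_eq_conjTranspose, Matrix.diagonal_conjTranspose]
    congr 1
    funext a
    show (starRingEnd ℂ) ((Real.exp (θ a) : ℂ)⁻¹) = _
    rw [map_inv₀, Complex.conj_ofReal]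
  have hDdD : Dinv * Matrix.diagonal (fun i => (d i : ℂ)) * Dinv = 1 := by
    rw [hDinv, Matrix.diagonal_mul_diagonal, Matrix.diagonal_mul_diagonal, ← Matrix.diagonal_one]
    congr 1
    funext a
    rw [← hexp a]
    push_cast
    field_simp
  set V : Matrix σ σ ℂ := g * U * Dinv with hV
  refine ⟨V, star U, θ, ?_, ?_, ?_, ?_⟩
  · -- `V` is unitary: `Vᴴ V = Dinv Uᴴ (gᴴ g) U Dinv = Dinv diag(d) Dinv = 1`
    rw [Matrix.mem_unitaryGroup_iff']
    have : star V * V = Dinv * (star U * (gᴴ * g) * U) * Dinv := by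
      rw [hV, star_mul, star_mul, hDstar, Matrix.star_eq_conjTranspose g]
      simp only [Matrix.mul_assoc]
    rw [this, hdec]
    have : star U * (U * Matrix.diagonal (fun i => (d i : ℂ)) * star U) * U =
        Matrix.diagonal (fun i => (d i : ℂ)) := by
      calc star U * (U * Matrix.diagonal (fun i => (d i : ℂ)) * star U) * U
          = (star U * U) * Matrix.diagonal (fun i => (d i : ℂ)) * (star U * U) := by
            simp only [Matrix.mul_assoc]
        _ = Matrix.diagonal (fun i => (d i : ℂ)) := by rw [hUU', Matrix.one_mul, Matrix.mul_one]
    rw [this, hDdD]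
  · rw [Matrix.mem_unitaryGroup_iff, star_star, hUU']
  · -- `∑ θ = (1/2) log ∏ d = 0`
    have : ∑ a, θ a = (∑ a, Real.log (d a)) / 2 := by
      rw [hθ, Finset.sum_div]
    rw [this, ← Real.log_prod (s := Finset.univ) (f := d) (fun a _ => (hdpos a).ne'), hdprod, Real.log_one, zero_div]
  · -- `V D Uᴴ = g U Dinv D Uᴴ = g`
    rw [hV]
    calc g = g * (U * star U) := by rw [hUU, Matrix.mul_one]
      _ = g * U * (Dinv * D) * star U := by rw [hDD, Matrix.mul_one, Matrix.mul_assoc]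
      _ = g * U * Dinv * D * star U := by simp only [Matrix.mul_assoc]


/-! ### Unitary invariance of row and column norms -/
section MatrixNorms

variable {σ : Type*} [Fintype σ] [DecidableEq σ]

/-- Column norms are invariant under left multiplication by `V` with `Vᴴ V = 1`. [folklore] -/
theorem colNormSq_mul_of_conjTranspose_mul_self {V : Matrix σ σ ℂ} (hV : Vᴴ * V = 1)
    (Y : Matrix σ σ ℂ) (a : σ) : ∑ i, ‖(V * Y) i a‖ ^ 2 = ∑ c, ‖Y c a‖ ^ 2 := by
  apply Complex.ofReal_injective
  push_cast
  simp_rw [← Complex.conj_mul', Matrix.mul_apply, map_sum, Finset.sum_mul, Finset.mul_sum, map_mul]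
  -- `∑ i ∑ c ∑ c' conj(V i c Y c a) (V i c' Y c' a) = ∑ c conj(Y c a) Y c a`
  rw [Finset.sum_comm]
  refine Finset.sum_congr rfl fun c _ => ?_
  rw [Finset.sum_comm]
  have : ∀ c', (∑ i, (starRingEnd ℂ) (V i c) * (starRingEnd ℂ) (Y c a) * (V i c' * Y c' a)) =
      (if c = c' then 1 else 0) * ((starRingEnd ℂ) (Y c a) * Y c' a) := by
    intro c'
    rw [← sum_conj_mul_eq_of_conjTranspose_mul_self hV c c', Finset.sum_mul]
    refine Finset.sum_congr rfl fun i _ => by ring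
  simp_rw [this]
  simp

/-- Row norms are invariant under right multiplication by `U` with `U Uᴴ = 1`. [folklore] -/
theorem rowNormSq_mul_of_mul_conjTranspose_self {U : Matrix σ σ ℂ} (hU : U * Uᴴ = 1)
    (M : Matrix σ σ ℂ) (i : σ) : ∑ a, ‖(M * U) i a‖ ^ 2 = ∑ c, ‖M i c‖ ^ 2 := by
  apply Complex.ofReal_injective
  push_cast
  simp_rw [← Complex.conj_mul', Matrix.mul_apply, map_sum, Finset.sum_mul, Finset.mul_sum, map_mul]
  rw [Finset.sum_comm]
  refine Finset.sum_congr rfl fun c _ => ?_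
  rw [Finset.sum_comm]
  have hrow : ∀ c', (∑ a, U c a * (starRingEnd ℂ) (U c' a)) = if c = c' then 1 else 0 := by
    intro c'
    have h := congr_fun (congr_fun hU c) c'
    rw [Matrix.mul_apply, Matrix.one_apply] at h
    simpa [Matrix.conjTranspose_apply] using h
  have : ∀ c', (∑ a, (starRingEnd ℂ) (M i c) * (starRingEnd ℂ) (U c a) * (M i c' * U c' a)) =
      (starRingEnd ℂ) (if c = c' then 1 else 0) * ((starRingEnd ℂ) (M i c) * M i c') := by
    intro c'
    rw [← hrow c', map_sum, Finset.sum_mul]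
    refine Finset.sum_congr rfl fun a _ => ?_
    rw [map_mul, Complex.conj_conj]
    ring
  simp_rw [this]
  simp

/-- The squared Frobenius norm `∑ i a, ‖(M * U) i a‖²` is invariant under right multiplication by a
unitary matrix. [folklore] -/
theorem frobSq_mul_of_mul_conjTranspose_self {U : Matrix σ σ ℂ} (hU : U * Uᴴ = 1)
    (M : Matrix σ σ ℂ) : ∑ i, ∑ a, ‖(M * U) i a‖ ^ 2 = ∑ i, ∑ c, ‖M i c‖ ^ 2 :=
  Finset.sum_congr rfl fun i _ => rowNormSq_mul_of_mul_conjTranspose_self hU M i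

/-- Column norms of `V * diag(exp θ) * X` for unitary `V`: `∑ i |(V D X) i a|² = ∑ c e^{2 θ c} |X c a|²`.
[folklore] -/
theorem colNormSq_unitary_mul_diagonal_mul {V : Matrix σ σ ℂ} (hV : Vᴴ * V = 1) (θ : σ → ℝ)
    (X : Matrix σ σ ℂ) (a : σ) :
    ∑ i, ‖(V * Matrix.diagonal (fun c => (Real.exp (θ c) : ℂ)) * X) i a‖ ^ 2 =
      ∑ c, Real.exp (2 * θ c) * ‖X c a‖ ^ 2 := by
  rw [Matrix.mul_assoc, colNormSq_mul_of_conjTranspose_mul_self hV]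
  refine Finset.sum_congr rfl fun c _ => ?_
  rw [Matrix.diagonal_mul, norm_mul, Complex.norm_real, Real.norm_eq_abs, abs_of_pos (Real.exp_pos _),
    mul_pow, ← Real.exp_nat_mul]
  norm_num

end MatrixNorms

end Literature.Computability.AlgebraicComplexity
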